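import Mathlib
import Literature.Analysis.SpecialFunctions.DilogarithmRealArgument
import HarnessLib

/-!
# The one-top datum `D2 = I(1,0,1,0,1,1,0,1)`, I: the `t₅`-kernel `C`, Landen on `(0,1)`, the `t₄`-kernel `M(y)`
# (cell `pub-zeta5`, seat ct-1 g21; item (3) of the wedge-dictionary programme; gen-1 g17 `LEVEL1-EXACT.md` Prop. B)

HONEST FRAMING: systematic search; no irrationality claim unless certified.  Elementary real analysis only (rational
functions, logarithms, the real dilogarithm `Li₂ = reDilog`); nothing here mentions the cellular integrals or `ζ(5)`.
0. `ftc_open` / `lintegral_ftc_open` — FTC-2 on an OPEN interval for a NON-NEGATIVE integrand whose primitive has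
   one-sided limits: integrability comes for free (`integrableOn_deriv_of_nonneg` on the continuous extension).
1. `integral_C` — `∫_a^1 (s−a)(1−s)/(s−b)² ds = (1+a−2b)·log((1−b)/(a−b)) − 2(1−a)` (`b < a < 1`), `C_nonneg`, `lintegral_C`.
2. `reDilog_landen` — `Li₂(−y/(1−y)) = −Li₂(y) − ½ log²(1−y)` on `(0,1)` for the INTEGRAL dilogarithm (the tree's
   `DilogarithmLanden` is the series version on `|x| < 1/2`).
3. `integral_K` — for `0 < y < 1`: `∫₀¹ t·[(1+t−2ty)·log((1−ty)/(t(1−y))) − 2(1−t)]/(1−t)² dt = M(y)`,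
   `M(y) := −(1−2y)log(1−y)/y − (3−4y)(π²/6 + Li₂(y) + ½log²(1−y)) + 4 + 2log(1−y)`, with integrability, `M_nonneg`,
   `lintegral_K`; ONE explicit primitive `Q` (its `log(1−t)` pieces cancel identically), `Q' = K` by `field_simp; ring`
   on the atoms `log t`, `log((1−ty)/(1−y))`, `Q → 2` at `1⁻` (a slope limit), `Q` continuous at `0`, then Landen.
`K`, `Q`, `M` are LOCAL NOTATIONS (theorems only); downstream files restate them verbatim.
-/
noncomputable section

open MeasureTheory Set Filter Topology intervalIntegral
open scoped ENNReal

namespace Summit.KontsevichZagierPeriods.Zeta5Search.WedgeDictionaryOneTop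

open Literature.Analysis.SpecialFunctions (reDilog reDilog_zero reDilog_one continuous_reDilog hasDerivAt_reDilog)

/-! ## 0. FTC on an open interval for a non-negative integrand -/

/-- FTC-2 on an open interval `(a,b)` for a NON-NEGATIVE integrand `f = F'` whose primitive `F` has one-sided limits
`Fa`, `Fb` at the endpoints: `f` is integrable on `(a,b)` (no bound needed: `integrableOn_deriv_of_nonneg` applied to
the continuous extension of `F`) and `∫_{(a,b)} f = Fb − Fa`. [folklore] -/
theorem ftc_open {a b Fa Fb : ℝ} (hab : a < b) {F f : ℝ → ℝ}
    (hderiv : ∀ x ∈ Ioo a b, HasDerivAt F (f x) x) (hpos : ∀ x ∈ Ioo a b, 0 ≤ f x)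
    (ha : Tendsto F (𝓝[>] a) (𝓝 Fa)) (hb : Tendsto F (𝓝[<] b) (𝓝 Fb)) :
    IntegrableOn f (Ioo a b) ∧ ∫ x in Ioo a b, f x = Fb - Fa := by
  set G : ℝ → ℝ := Function.update (Function.update F a Fa) b Fb with hG
  have Gderiv : ∀ x ∈ Ioo a b, HasDerivAt G (f x) x := by
    intro x hx
    refine (hderiv x hx).congr_of_eventuallyEq ?_
    filter_upwards [Ioo_mem_nhds hx.1 hx.2] with y hy
    simp only [hG, Function.update_of_ne hy.2.ne, Function.update_of_ne hy.1.ne']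
  have Gcont : ContinuousOn G (Icc a b) := by
    rw [hG, continuousOn_update_iff, continuousOn_update_iff, Icc_sdiff_right, Ico_sdiff_left]
    refine ⟨⟨fun z hz => (hderiv z hz).continuousAt.continuousWithinAt, ?_⟩, ?_⟩
    · exact fun _ => ha.mono_left (nhdsWithin_mono _ Ioo_subset_Ioi_self)
    · rintro -
      refine (hb.congr' ?_).mono_left (nhdsWithin_mono _ Ico_subset_Iio_self)
      filter_upwards [Ioo_mem_nhdsLT hab] with _ hz using (Function.update_of_ne hz.1.ne' _ _).symm
  have hint : IntegrableOn f (Ioc a b) := intervalIntegral.integrableOn_deriv_of_nonneg Gcont Gderiv hpos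
  refine ⟨hint.mono_set Ioo_subset_Ioc_self, ?_⟩
  have h := intervalIntegral.integral_eq_sub_of_hasDerivAt_of_tendsto hab hderiv
    ((intervalIntegrable_iff_integrableOn_Ioc_of_le hab.le).2 hint) ha hb
  rw [intervalIntegral.integral_of_le hab.le, integral_Ioc_eq_integral_Ioo] at h
  exact h

/-- The `ℝ≥0∞` form of `ftc_open`, with a non-negative constant factor:
`∫⁻_{(a,b)} ofReal (K·f) = ofReal (K·(Fb − Fa))`. [folklore] -/
theorem lintegral_ftc_open {a b Fa Fb K : ℝ} (hab : a < b) {F f : ℝ → ℝ}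
    (hderiv : ∀ x ∈ Ioo a b, HasDerivAt F (f x) x) (hpos : ∀ x ∈ Ioo a b, 0 ≤ f x)
    (ha : Tendsto F (𝓝[>] a) (𝓝 Fa)) (hb : Tendsto F (𝓝[<] b) (𝓝 Fb)) (hK : 0 ≤ K) :
    ∫⁻ x in Ioo a b, ENNReal.ofReal (K * f x) = ENNReal.ofReal (K * (Fb - Fa)) := by
  obtain ⟨hI, hv⟩ := ftc_open hab hderiv hpos ha hb
  have hnn : 0 ≤ᵐ[volume.restrict (Ioo a b)] fun x => K * f x :=
    (ae_restrict_mem measurableSet_Ioo).mono fun x hx => mul_nonneg hK (hpos x hx)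
  rw [← ofReal_integral_eq_lintegral_ofReal (hI.const_mul K) hnn, MeasureTheory.integral_const_mul, hv]

/-! ## 1. The `t₅`-step: `∫_a^1 (s−a)(1−s)/(s−b)² ds = C(b,a) := (1 + a − 2b) log((1−b)/(a−b)) − 2(1−a)` (`b < a < 1`) -/

/-- The `t₅`-integral of the one-top integrand: for `b < a < 1`,
`∫_{(a,1)} (s−a)(1−s)/(s−b)² ds = (1 + a − 2b)·log((1−b)/(a−b)) − 2(1−a)`, with integrability
(primitive `−s + (1+a−2b) log(s−b) + (a−b)(1−b)/(s−b)`; gen-1 g17 `LEVEL1-EXACT.md` (l5‴)). [folklore] -/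
theorem integral_C {a b : ℝ} (hba : b < a) (ha1 : a < 1) :
    IntegrableOn (fun s : ℝ => (s - a) * (1 - s) / (s - b) ^ 2) (Ioo a 1) ∧
      ∫ s in Ioo a 1, (s - a) * (1 - s) / (s - b) ^ 2 =
        (1 + a - 2 * b) * Real.log ((1 - b) / (a - b)) - 2 * (1 - a) := by
  have key := ftc_open (F := fun s : ℝ => -s + (1 + a - 2 * b) * Real.log (s - b) + (a - b) * (1 - b) / (s - b))
    (f := fun s : ℝ => (s - a) * (1 - s) / (s - b) ^ 2)
    (Fa := -a + (1 + a - 2 * b) * Real.log (a - b) + (a - b) * (1 - b) / (a - b))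
    (Fb := -1 + (1 + a - 2 * b) * Real.log (1 - b) + (a - b) * (1 - b) / (1 - b)) ha1 ?_ ?_ ?_ ?_
  · refine ⟨key.1, ?_⟩
    rw [key.2]
    have h1 : a - b ≠ 0 := by linarith
    have h2 : 1 - b ≠ 0 := by linarith
    rw [Real.log_div h2 h1]
    field_simp; ring
  · intro s hs
    have hsb : s - b ≠ 0 := by linarith [hs.1]
    have h := ((((hasDerivAt_id' s).neg).add (((hasDerivAt_id' s).sub_const b).log hsb |>.const_mul
      (1 + a - 2 * b))).add ((hasDerivAt_const s ((a - b) * (1 - b))).div ((hasDerivAt_id' s).sub_const b) hsb))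
    refine h.congr_deriv ?_
    field_simp; ring
  · intro s hs
    exact div_nonneg (mul_nonneg (by linarith [hs.1]) (by linarith [hs.2])) (sq_nonneg _)
  · have hcont : ContinuousAt (fun s : ℝ => -s + (1 + a - 2 * b) * Real.log (s - b) + (a - b) * (1 - b) / (s - b)) a := by
      have h1 : a - b ≠ 0 := by linarith
      fun_prop (disch := assumption)
    exact hcont.tendsto.mono_left nhdsWithin_le_nhds
  · have hcont : ContinuousAt (fun s : ℝ => -s + (1 + a - 2 * b) * Real.log (s - b) + (a - b) * (1 - b) / (s - b)) 1 := by
      have h1 : (1:ℝ) - b ≠ 0 := by linarith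
      fun_prop (disch := assumption)
    exact hcont.tendsto.mono_left nhdsWithin_le_nhds

/-- `C(b,a) ≥ 0` for `b < a < 1` (it is the integral of a non-negative function). [folklore] -/
theorem C_nonneg {a b : ℝ} (hba : b < a) (ha1 : a < 1) :
    0 ≤ (1 + a - 2 * b) * Real.log ((1 - b) / (a - b)) - 2 * (1 - a) := by
  rw [← (integral_C hba ha1).2]
  refine setIntegral_nonneg measurableSet_Ioo fun s hs => ?_
  have h1 : 0 ≤ s - a := by linarith [hs.1]
  have h2 : 0 ≤ 1 - s := by linarith [hs.2]
  positivity

/-- `ℝ≥0∞` form of the `t₅`-step with a constant factor `K ≥ 0`. [folklore] -/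
theorem lintegral_C {a b K : ℝ} (hba : b < a) (ha1 : a < 1) (hK : 0 ≤ K) :
    ∫⁻ s in Ioo a 1, ENNReal.ofReal (K * ((s - a) * (1 - s) / (s - b) ^ 2)) =
      ENNReal.ofReal (K * ((1 + a - 2 * b) * Real.log ((1 - b) / (a - b)) - 2 * (1 - a))) := by
  obtain ⟨hI, hv⟩ := integral_C hba ha1
  have hnn : 0 ≤ᵐ[volume.restrict (Ioo a 1)] fun s => K * ((s - a) * (1 - s) / (s - b) ^ 2) :=
    (ae_restrict_mem measurableSet_Ioo).mono fun s hs => by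
      have h1 : 0 ≤ s - a := by linarith [hs.1]
      have h2 : 0 ≤ 1 - s := by linarith [hs.2]
      positivity
  rw [← ofReal_integral_eq_lintegral_ofReal (hI.const_mul K) hnn, MeasureTheory.integral_const_mul, hv]

/-! ## 2. Landen's identity for `reDilog` on `(0,1)`: `Li₂(−y/(1−y)) = −Li₂(y) − ½ log²(1−y)` -/

/-- Derivative computation: `y ↦ Li₂(−y/(1−y)) + Li₂(y) + ½ log²(1−y)` has derivative `0` on `(0,1)`. [folklore] -/
theorem hasDerivAt_landen_aux {y : ℝ} (h0 : 0 < y) (h1 : y < 1) :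
    HasDerivAt (fun y : ℝ => reDilog (-(y / (1 - y))) + reDilog y + Real.log (1 - y) ^ 2 / 2) 0 y := by
  have hy1 : 1 - y ≠ 0 := by intro h; linarith
  have hz : 0 < y / (1 - y) := div_pos h0 (by linarith)
  have hz0 : -(y / (1 - y)) ≠ 0 := by linarith
  have hz1 : -(y / (1 - y)) ≠ 1 := by linarith
  -- inner map
  have hg : HasDerivAt (fun y : ℝ => -(y / (1 - y))) (-(1 / (1 - y) ^ 2)) y := by
    have h := ((hasDerivAt_id' y).div ((hasDerivAt_id' y).const_sub 1) hy1).neg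
    refine h.congr_deriv ?_
    field_simp; ring
  have hA := (hasDerivAt_reDilog hz0 hz1).comp y hg
  have hlog : Real.log (1 - -(y / (1 - y))) = -Real.log (1 - y) := by
    rw [show 1 - -(y / (1 - y)) = (1 - y)⁻¹ by field_simp; ring, Real.log_inv]
  rw [hlog] at hA
  have hB := hasDerivAt_reDilog h0.ne' h1.ne
  have hC : HasDerivAt (fun y : ℝ => Real.log (1 - y) ^ 2 / 2) (2 * Real.log (1 - y) * (-1 / (1 - y)) / 2) y := by
    have h := ((((hasDerivAt_id' y).const_sub 1).log hy1).pow 2).div_const 2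
    refine h.congr_deriv ?_
    norm_num
  refine ((hA.add hB).add hC).congr_deriv ?_
  field_simp; ring

/-- **Landen's identity** for the real dilogarithm on `(0,1)`: `Li₂(−y/(1−y)) = −Li₂(y) − ½ log²(1−y)`
(Zagier 2007, Ch. I §2; the tree's `DilogarithmLanden` has the series version for `|x| < 1/2`). Proof: zero derivative
on `(0,1)` and limit `0` at `0⁺`. [folklore] -/
theorem reDilog_landen {y : ℝ} (h0 : 0 < y) (h1 : y < 1) :
    reDilog (-(y / (1 - y))) = -reDilog y - Real.log (1 - y) ^ 2 / 2 := by
  set ψ : ℝ → ℝ := fun y => reDilog (-(y / (1 - y))) + reDilog y + Real.log (1 - y) ^ 2 / 2 with hψ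
  have hconst : ∀ a ∈ Ioo (0:ℝ) 1, ∀ b ∈ Ioo (0:ℝ) 1, ψ a = ψ b := by
    intro a ha b hb
    refine IsOpen.is_const_of_deriv_eq_zero isOpen_Ioo (convex_Ioo _ _).isPreconnected ?_ ?_ ha hb
    · intro z hz
      exact (hasDerivAt_landen_aux hz.1 hz.2).differentiableAt.differentiableWithinAt
    · intro z hz
      exact (hasDerivAt_landen_aux hz.1 hz.2).deriv
  have hcont : ContinuousAt ψ 0 := by
    have h : Continuous reDilog := continuous_reDilog
    refine ContinuousAt.add (ContinuousAt.add ?_ h.continuousAt) ?_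
    · exact h.continuousAt.comp (by fun_prop (disch := norm_num))
    · fun_prop (disch := norm_num)
  have hψ0 : ψ 0 = 0 := by simp [hψ, reDilog_zero]
  have hlim : Tendsto ψ (𝓝[>] (0:ℝ)) (𝓝 0) := by simpa [hψ0] using hcont.tendsto.mono_left (nhdsWithin_le_nhds (s := Ioi (0:ℝ)))
  have hev : ψ =ᶠ[𝓝[>] (0:ℝ)] fun _ => ψ y := by
    filter_upwards [Ioo_mem_nhdsGT (zero_lt_one' ℝ)] with z hz using hconst z hz y ⟨h0, h1⟩
  have hval : (0:ℝ) = ψ y := tendsto_nhds_unique_of_eventuallyEq hlim tendsto_const_nhds hev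
  have : ψ y = reDilog (-(y / (1 - y))) + reDilog y + Real.log (1 - y) ^ 2 / 2 := rfl
  linarith

/-! ## 3. The `t₄`-kernel: `M(y) = ∫₀¹ t·C(ty,t)/(1−t)² dt` in closed form -/

/-- The primitive used for the `t₄`-integration (for fixed `y`):
`Q(t) = −(1−2y)[(1−ty)/y·B + t log t] − (3−4y)[Li₂(−y(1−t)/(1−y)) − Li₂(1−t)] − 2(1−y)[(t log t − B)/(1−t) − y/(1−y)·B] − 2(1−t)`,
`B = log((1−ty)/(1−y))` (a local notation). -/
local notation "Qp⟪" y ", " t "⟫" => (-(1 - 2 * y) * ((1 - t * y) / y * Real.log ((1 - t * y) / (1 - y)) + t * Real.log t)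
    - (3 - 4 * y) * (reDilog (-(y * (1 - t) / (1 - y))) - reDilog (1 - t))
    - 2 * (1 - y) * ((t * Real.log t - Real.log ((1 - t * y) / (1 - y))) / (1 - t)
        - y / (1 - y) * Real.log ((1 - t * y) / (1 - y)))
    - 2 * (1 - t))

/-- The `t₄`-integrand `K(y,t) = t·[(1+t−2ty) log((1−ty)/(t(1−y))) − 2(1−t)]/(1−t)²` (local notation). -/
local notation "Kk⟪" y ", " t "⟫" => (t * ((1 + t - 2 * (t * y)) * Real.log ((1 - t * y) / (t * (1 - y))) - 2 * (1 - t)) / (1 - t) ^ 2)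

/-- `K(y,t) ≥ 0` on `(0,1)²` (`K = t·C(ty,t)/(1−t)²` with `C ≥ 0`). [folklore] -/
theorem K_nonneg {y t : ℝ} (hy1 : y < 1) (ht0 : 0 < t) (ht1 : t < 1) : 0 ≤ Kk⟪y, t⟫ := by
  have hC := C_nonneg (a := t) (b := t * y) (by nlinarith) ht1
  rw [show t - t * y = t * (1 - y) by ring] at hC
  have h1 : 0 ≤ (1 - t) ^ 2 := sq_nonneg _
  positivity

/-- `Q'(t) = K(y,t)` on `(0,1)` (for `0 < y < 1`). [folklore] -/
theorem hasDerivAt_Q {y t : ℝ} (hy0 : 0 < y) (hy1 : y < 1) (ht0 : 0 < t) (ht1 : t < 1) :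
    HasDerivAt (fun t : ℝ => Qp⟪y, t⟫) (Kk⟪y, t⟫) t := by
  have hy : y ≠ 0 := hy0.ne'
  have hy1' : 1 - y ≠ 0 := by intro h; linarith
  have ht : t ≠ 0 := ht0.ne'
  have ht1' : 1 - t ≠ 0 := by intro h; linarith
  have hty : 1 - t * y ≠ 0 := by nlinarith
  have hty2 : 1 - y * t ≠ 0 := by rwa [mul_comm] at hty
  have hty' : 0 < 1 - t * y := by nlinarith
  -- B(t) = log((1 - t y)/(1 - y)) and its derivative
  have hB : HasDerivAt (fun t : ℝ => Real.log ((1 - t * y) / (1 - y))) (-y / (1 - t * y)) t := by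
    have hin : HasDerivAt (fun t : ℝ => (1 - t * y) / (1 - y)) (-y / (1 - y)) t := by
      have h := (((hasDerivAt_id' t).mul_const y).const_sub 1).div_const (1 - y)
      refine h.congr_deriv ?_; ring
    have h := hin.log (by positivity)
    refine h.congr_deriv ?_
    field_simp
  have hA : HasDerivAt (fun t : ℝ => t * Real.log t) (Real.log t + 1) t := by
    have h := (hasDerivAt_id' t).mul (Real.hasDerivAt_log ht)
    refine h.congr_deriv ?_
    field_simp
  -- the two dilogarithms
  have hz : 0 < y * (1 - t) / (1 - y) := by positivity
  have hz0 : -(y * (1 - t) / (1 - y)) ≠ 0 := by linarith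
  have hz1 : -(y * (1 - t) / (1 - y)) ≠ 1 := by linarith
  have hD1 : HasDerivAt (fun t : ℝ => reDilog (-(y * (1 - t) / (1 - y))))
      (Real.log ((1 - t * y) / (1 - y)) / (1 - t)) t := by
    have hin : HasDerivAt (fun t : ℝ => -(y * (1 - t) / (1 - y))) (y / (1 - y)) t := by
      have h := ((((hasDerivAt_id' t).const_sub 1).const_mul y).div_const (1 - y)).neg
      refine h.congr_deriv ?_; ring
    have h := (hasDerivAt_reDilog hz0 hz1).comp t hin
    have hlog : Real.log (1 - -(y * (1 - t) / (1 - y))) = Real.log ((1 - t * y) / (1 - y)) := by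
      congr 1; field_simp; ring
    rw [hlog] at h
    refine h.congr_deriv ?_
    field_simp
  have hD2 : HasDerivAt (fun t : ℝ => reDilog (1 - t)) (Real.log t / (1 - t)) t := by
    have h := (hasDerivAt_reDilog ht1' (by intro h; apply ht; linarith)).comp t ((hasDerivAt_id' t).const_sub 1)
    refine h.congr_deriv ?_
    rw [sub_sub_cancel]
    ring
  -- assemble (with pre-simplified derivatives; `B = log((1 - t y)/(1 - y))`, `A = log t` are atoms)
  have hT1 : HasDerivAt (fun t : ℝ => (1 - t * y) / y * Real.log ((1 - t * y) / (1 - y)) + t * Real.log t)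
      (Real.log t - Real.log ((1 - t * y) / (1 - y))) t := by
    have hlin : HasDerivAt (fun t : ℝ => (1 - t * y) / y) (-1) t := by
      have h := (((hasDerivAt_id' t).mul_const y).const_sub 1).div_const y
      exact h.congr_deriv (by field_simp)
    refine ((hlin.mul hB).add hA).congr_deriv ?_
    field_simp; ring
  have hT3 : HasDerivAt (fun t : ℝ => (t * Real.log t - Real.log ((1 - t * y) / (1 - y))) / (1 - t)
        - y / (1 - y) * Real.log ((1 - t * y) / (1 - y)))
      (((Real.log t + 1) * (1 - t) + t * Real.log t - Real.log ((1 - t * y) / (1 - y))) / (1 - t) ^ 2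
        + y / ((1 - t * y) * (1 - t)) + y ^ 2 / ((1 - y) * (1 - t * y))) t := by
    refine (((hA.sub hB).div ((hasDerivAt_id' t).const_sub 1) ht1').sub (hB.const_mul _)).congr_deriv ?_
    simp only [Pi.sub_apply]
    generalize Real.log ((1 - t * y) / (1 - y)) = B
    generalize Real.log t = A
    field_simp; ring
  have hT4 : HasDerivAt (fun t : ℝ => 2 * (1 - t)) (-2) t := by
    refine (((hasDerivAt_id' t).const_sub 1).const_mul 2).congr_deriv ?_; ring
  have hD : HasDerivAt (fun t : ℝ => reDilog (-(y * (1 - t) / (1 - y))) - reDilog (1 - t))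
      ((Real.log ((1 - t * y) / (1 - y)) - Real.log t) / (1 - t)) t := by
    refine (hD1.sub hD2).congr_deriv ?_
    field_simp
  have hQ := (((hT1.const_mul (-(1 - 2 * y))).sub (hD.const_mul (3 - 4 * y))).sub
    (hT3.const_mul (2 * (1 - y)))).sub hT4
  refine hQ.congr_deriv ?_
  have e1 : Real.log ((1 - t * y) / (t * (1 - y))) = Real.log ((1 - t * y) / (1 - y)) - Real.log t := by
    rw [show (1 - t * y) / (t * (1 - y)) = ((1 - t * y) / (1 - y)) / t by field_simp,
      Real.log_div (by positivity) ht]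
  rw [e1]
  generalize Real.log ((1 - t * y) / (1 - y)) = B
  generalize Real.log t = A
  field_simp; ring

/-- The closed form of the `t₄`-kernel:
`M(y) = −(1−2y) log(1−y)/y − (3−4y)(π²/6 + Li₂(y) + ½ log²(1−y)) + 4 + 2 log(1−y)` (local notation). -/
local notation "Mm⟪" y "⟫" => (-(1 - 2 * y) * Real.log (1 - y) / y
    - (3 - 4 * y) * (Real.pi ^ 2 / 6 + reDilog y + Real.log (1 - y) ^ 2 / 2) + 4 + 2 * Real.log (1 - y))

/-- `Q(t) → 2` as `t → 1⁻` (the only non-trivial piece is `(t log t − B)/(1−t) → −1/(1−y)`, a derivative at `t = 1`).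
[folklore] -/
theorem tendsto_Q_one {y : ℝ} (hy0 : 0 < y) (hy1 : y < 1) :
    Tendsto (fun t : ℝ => Qp⟪y, t⟫) (𝓝[<] 1) (𝓝 2) := by
  have hy : y ≠ 0 := hy0.ne'
  have hy1' : 1 - y ≠ 0 := by intro h; linarith
  have hone : (1 - 1 * y) / (1 - y) = 1 := by rw [one_mul]; exact div_self hy1'
  -- the slope piece
  have hB1 : HasDerivAt (fun t : ℝ => Real.log ((1 - t * y) / (1 - y))) (-y / (1 - 1 * y)) 1 := by
    have hin : HasDerivAt (fun t : ℝ => (1 - t * y) / (1 - y)) (-y / (1 - y)) 1 := by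
      have h := (((hasDerivAt_id' (1:ℝ)).mul_const y).const_sub 1).div_const (1 - y)
      refine h.congr_deriv ?_; ring
    have h := hin.log (by rw [hone]; norm_num)
    refine h.congr_deriv ?_
    rw [one_mul]
    field_simp
  have hA1 : HasDerivAt (fun t : ℝ => t * Real.log t) (Real.log 1 + 1) 1 := by
    have h := (hasDerivAt_id' (1:ℝ)).mul (Real.hasDerivAt_log one_ne_zero)
    refine h.congr_deriv ?_
    simp
  have hg := (hA1.sub hB1).tendsto_slope
  have hg1 : (1 : ℝ) * Real.log 1 - Real.log ((1 - 1 * y) / (1 - y)) = 0 := by rw [hone]; simp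
  have hT3 : Tendsto (fun t : ℝ => (t * Real.log t - Real.log ((1 - t * y) / (1 - y))) / (1 - t))
      (𝓝[≠] 1) (𝓝 (-(Real.log 1 + 1 - -y / (1 - 1 * y)))) := by
    refine hg.neg.congr' ?_
    filter_upwards [self_mem_nhdsWithin] with t ht
    rw [slope_def_field]
    simp only [Pi.sub_apply]
    rw [hg1, sub_zero]
    have h1 : t - 1 ≠ 0 := sub_ne_zero.2 ht
    have h2 : 1 - t ≠ 0 := fun h => h1 (by linarith)
    field_simp; ring
  have hT3' := hT3.mono_left (nhdsWithin_mono _ (fun t (ht : t < 1) => ht.ne) : 𝓝[<] (1:ℝ) ≤ 𝓝[≠] 1)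
  -- the continuous pieces
  have hc : Continuous reDilog := continuous_reDilog
  have hml : Continuous (fun t : ℝ => t * Real.log t) := Real.continuous_mul_log
  have hBc : ContinuousAt (fun t : ℝ => Real.log ((1 - t * y) / (1 - y))) 1 := by
    refine ContinuousAt.log (by fun_prop) ?_
    rw [hone]; norm_num
  have hT1 : Tendsto (fun t : ℝ => (1 - t * y) / y * Real.log ((1 - t * y) / (1 - y)) + t * Real.log t)
      (𝓝[<] 1) (𝓝 ((1 - 1 * y) / y * Real.log ((1 - 1 * y) / (1 - y)) + 1 * Real.log 1)) := by
    have h : ContinuousAt (fun t : ℝ => (1 - t * y) / y * Real.log ((1 - t * y) / (1 - y)) + t * Real.log t) 1 :=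
      ((by fun_prop : ContinuousAt (fun t : ℝ => (1 - t * y) / y) 1).mul hBc).add hml.continuousAt
    exact h.tendsto.mono_left nhdsWithin_le_nhds
  have hT2 : Tendsto (fun t : ℝ => reDilog (-(y * (1 - t) / (1 - y))) - reDilog (1 - t))
      (𝓝[<] 1) (𝓝 (reDilog (-(y * (1 - 1) / (1 - y))) - reDilog (1 - 1))) := by
    have h : ContinuousAt (fun t : ℝ => reDilog (-(y * (1 - t) / (1 - y))) - reDilog (1 - t)) 1 := by fun_prop
    exact h.tendsto.mono_left nhdsWithin_le_nhds
  have hBt : Tendsto (fun t : ℝ => y / (1 - y) * Real.log ((1 - t * y) / (1 - y))) (𝓝[<] 1)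
      (𝓝 (y / (1 - y) * Real.log ((1 - 1 * y) / (1 - y)))) :=
    (hBc.tendsto.mono_left nhdsWithin_le_nhds).const_mul _
  have hT4 : Tendsto (fun t : ℝ => 2 * (1 - t)) (𝓝[<] 1) (𝓝 (2 * (1 - 1))) :=
    ((by fun_prop : Continuous (fun t : ℝ => 2 * (1 - t))).tendsto 1).mono_left nhdsWithin_le_nhds
  have hall := ((((hT1.const_mul (-(1 - 2 * y))).sub (hT2.const_mul (3 - 4 * y))).sub
    ((hT3'.sub hBt).const_mul (2 * (1 - y)))).sub hT4)
  have hval : -(1 - 2 * y) * ((1 - 1 * y) / y * Real.log ((1 - 1 * y) / (1 - y)) + 1 * Real.log 1) -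
      (3 - 4 * y) * (reDilog (-(y * (1 - 1) / (1 - y))) - reDilog (1 - 1)) -
      2 * (1 - y) * (-(Real.log 1 + 1 - -y / (1 - 1 * y)) - y / (1 - y) * Real.log ((1 - 1 * y) / (1 - y))) -
      2 * (1 - 1) = (2:ℝ) := by
    rw [hone, sub_self, Real.log_one]
    simp only [mul_zero, zero_div, neg_zero, reDilog_zero, sub_zero, add_zero, one_mul, zero_add]
    field_simp; ring
  rw [hval] at hall
  exact hall

/-- `Q` is continuous at `t = 0` (every piece is; `t log t → 0`). [folklore] -/
theorem continuousAt_Q_zero {y : ℝ} (hy1 : y < 1) : ContinuousAt (fun t : ℝ => Qp⟪y, t⟫) 0 := by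
  have hy1' : 1 - y ≠ 0 := by intro h; linarith
  have hc : Continuous reDilog := continuous_reDilog
  have hml : Continuous (fun t : ℝ => t * Real.log t) := Real.continuous_mul_log
  have hBc : ContinuousAt (fun t : ℝ => Real.log ((1 - t * y) / (1 - y))) 0 := by
    refine ContinuousAt.log (by fun_prop) ?_
    rw [zero_mul, sub_zero]; positivity
  have hT1 : ContinuousAt (fun t : ℝ => (1 - t * y) / y * Real.log ((1 - t * y) / (1 - y)) + t * Real.log t) 0 :=
    ((by fun_prop : ContinuousAt (fun t : ℝ => (1 - t * y) / y) 0).mul hBc).add hml.continuousAt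
  have hT2 : ContinuousAt (fun t : ℝ => reDilog (-(y * (1 - t) / (1 - y))) - reDilog (1 - t)) 0 := by fun_prop
  have hT3 : ContinuousAt (fun t : ℝ => (t * Real.log t - Real.log ((1 - t * y) / (1 - y))) / (1 - t)
      - y / (1 - y) * Real.log ((1 - t * y) / (1 - y))) 0 :=
    ((hml.continuousAt.sub hBc).div (by fun_prop) (by norm_num)).sub (hBc.const_mul _)
  have hT4 : ContinuousAt (fun t : ℝ => 2 * (1 - t)) 0 := by fun_prop
  exact (((hT1.const_mul _).sub (hT2.const_mul _)).sub (hT3.const_mul _)).sub hT4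

/-- The value `2 − Q(0)` is the closed form `M(y)` (uses `Li₂(1) = π²/6` and Landen). [folklore] -/
theorem two_sub_Q_zero {y : ℝ} (hy0 : 0 < y) (hy1 : y < 1) : 2 - Qp⟪y, 0⟫ = Mm⟪y⟫ := by
  have hy : y ≠ 0 := hy0.ne'
  have hy1' : 1 - y ≠ 0 := by intro h; linarith
  have hL : Real.log ((1 - 0 * y) / (1 - y)) = -Real.log (1 - y) := by
    rw [zero_mul, sub_zero, one_div, Real.log_inv]
  rw [hL, show -(y * (1 - 0) / (1 - y)) = -(y / (1 - y)) by ring, reDilog_landen hy0 hy1, sub_zero, reDilog_one]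
  simp only [zero_mul, sub_zero]
  field_simp; ring

/-- **The `t₄`-kernel in closed form**: for `0 < y < 1`, `K(y,·)` is integrable on `(0,1)` and
`∫₀¹ t·C(ty,t)/(1−t)² dt = M(y) = −(1−2y)log(1−y)/y − (3−4y)(π²/6 + Li₂(y) + ½log²(1−y)) + 4 + 2log(1−y)`
(gen-1 g17 `LEVEL1-EXACT.md` Prop. B "The kernel", there via `P1 + P2 + P3` with cancelling `log ε` terms and Landen; here
ONE primitive `Q` whose `log δ` terms cancel identically, FTC on the open interval, Landen at the end). [folklore] -/
theorem integral_K {y : ℝ} (hy0 : 0 < y) (hy1 : y < 1) :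
    IntegrableOn (fun t : ℝ => Kk⟪y, t⟫) (Ioo 0 1) ∧ ∫ t in Ioo (0:ℝ) 1, Kk⟪y, t⟫ = Mm⟪y⟫ := by
  have h := ftc_open (F := fun t : ℝ => Qp⟪y, t⟫) (f := fun t : ℝ => Kk⟪y, t⟫) zero_lt_one
    (fun t ht => hasDerivAt_Q hy0 hy1 ht.1 ht.2) (fun t ht => K_nonneg hy1 ht.1 ht.2)
    ((continuousAt_Q_zero hy1).tendsto.mono_left nhdsWithin_le_nhds) (tendsto_Q_one hy0 hy1)
  rw [two_sub_Q_zero hy0 hy1] at h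
  exact h

/-- `M(y) ≥ 0` on `(0,1)`. [folklore] -/
theorem M_nonneg {y : ℝ} (hy0 : 0 < y) (hy1 : y < 1) : 0 ≤ Mm⟪y⟫ := by
  rw [← (integral_K hy0 hy1).2]
  exact setIntegral_nonneg measurableSet_Ioo fun t ht => K_nonneg hy1 ht.1 ht.2

/-- `ℝ≥0∞` form of the `t₄`-step with a constant factor `c ≥ 0`. [folklore] -/
theorem lintegral_K {y c : ℝ} (hy0 : 0 < y) (hy1 : y < 1) (hc : 0 ≤ c) :
    ∫⁻ t in Ioo (0:ℝ) 1, ENNReal.ofReal (c * Kk⟪y, t⟫) = ENNReal.ofReal (c * Mm⟪y⟫) := by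
  obtain ⟨hI, hv⟩ := integral_K hy0 hy1
  have hnn : 0 ≤ᵐ[volume.restrict (Ioo (0:ℝ) 1)] fun t => c * Kk⟪y, t⟫ :=
    (ae_restrict_mem measurableSet_Ioo).mono fun t ht => mul_nonneg hc (K_nonneg hy1 ht.1 ht.2)
  rw [← ofReal_integral_eq_lintegral_ofReal (hI.const_mul c) hnn, MeasureTheory.integral_const_mul, hv]

end Summit.KontsevichZagierPeriods.Zeta5Search.WedgeDictionaryOneTop
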